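import Mathlib.Geometry.Manifold.Instances.Real
import Literature.Topology.FourManifolds.ComplexProjectiveSpace
import Literature.AlgebraicGeometry.Motives.GAGAKaehlerProofs
import Literature.Geometry.Kaehler.ManifoldFormsPullback
import HarnessLib

/-!
# The Fubini–Study symplectic form on the tree's real-charted `ℂℙⁿ`

Topic `Literature/Geometry/Kaehler`. The tree has TWO manifold structures on the type
`Projectivization ℂ (Fin (n + 1) → ℂ)`:

* the REAL one, `Literature.Topology.FourManifolds.ComplexProjectiveSpace n`
  (`Literature/Topology/FourManifolds/ComplexProjectiveSpace.lean`): charts `affineChart i` valued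
  in `EuclideanSpace ℝ (Fin (2 * n))` through `realCoordinates`, `IsManifold (𝓡 (2 * n)) ω`, all
  point-set instances, and `ComplexProjectivePlane` re-exported at the literal model
  `EuclideanSpace ℝ (Fin 4)` — the carrier used by the 4-manifold statements of the tree;
* the COMPLEX one, `ℙ ℂ (Fin (n + 1) → ℂ)` with `Projectivization.instChartedSpace`
  (`Literature/NumberTheory/Transcendental/ProjectiveSpace.lean`), on which the Fubini–Study KÄHLER
  metric `FubiniStudy.fubiniStudyMetric` lives (`Literature/AlgebraicGeometry/Motives/GAGAKaehlerProofs.lean`,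
  real tangent model `𝓘(ℝ, Fin n → ℂ)`).

This file transports the Fubini–Study form from the second to the first:

* `CPn.toP : ComplexProjectiveSpace n ≃ ℙ ℂ (Fin (n + 1) → ℂ)` — the identity; it is continuous
  and `C^∞` in both directions (`CPn.contMDiff_toP`, `CPn.contMDiff_toP_symm`: in the preferred
  charts it is a change of affine charts `φ_c ∘ φⱼ⁻¹` composed with `realCoordinates`, real-analytic
  by `Projectivization.contDiffOn_stdChartFun_comp_stdChartInv`), hence its differential is
  bijective (`CPn.bijective_mfderiv_toP`);
* `CPn.contMDiffAt_iff_affineChart` — smoothness of a map INTO `ComplexProjectiveSpace n` is tested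
  on the complex affine coordinates `affineCoordComplex i` of any chart containing the image point;
* `CPn.fsForm n : MForm (𝓡 (2 * n)) (ComplexProjectiveSpace n) ℝ 2` — the pull-back along `toP` of
  the Kähler form of the Fubini–Study metric; smooth and closed by the tree's pull-back calculus
  (`ManifoldFormsPullback`), non-degenerate because `dtoP` is bijective and the Kähler form of a
  Hermitian metric is non-degenerate (`CPn.isSmoothForm_fsForm`, `CPn.isClosedForm_fsForm`,
  `CPn.fsForm_nondegenerate`): a symplectic form on `ℂℙⁿ` in the tree's `𝓡 (2 * n)` vocabulary
  (at `n = 2`, the literal `𝓡 4` through `ComplexProjectivePlane`).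

## References

* D. Huybrechts, *Complex Geometry* (2005), §2.1 pp. 56–57 (the affine atlas), §3.1 Examples
  3.1.9 i) pp. 117–118 (the Fubini–Study form is a Kähler, in particular symplectic, form).
* D. McDuff, D. Salamon, *Introduction to Symplectic Topology*, 3rd ed. (2017), Example 4.3.3.
-/

noncomputable section

open scoped Manifold ContDiff Topology LinearAlgebra.Projectivization
open Set Function Module Projectivization
open Literature.NumberTheory.Transcendental Literature.AlgebraicGeometry.Motives.FubiniStudy
open Literature.Topology.FourManifolds Literature.Topology.FourManifolds.ComplexProjectiveSpace

namespace Literature.Geometry.Kaehler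

/-- Local-instance spelling of the tree's theorem `isManifold_projectivization_holds`: `ℙⁿ(ℂ)` is a
complex-analytic manifold. [cite: HuybrechtsCG2005, §2.1 pp. 56–57] -/
theorem isManifold_complex_projectivization (n : ℕ) :
    IsManifold 𝓘(ℂ, Fin n → ℂ) ω (ℙ ℂ (Fin (n + 1) → ℂ)) :=
  isManifold_projectivization_holds ℂ n

/-- Local-instance spelling: `ℙⁿ(ℂ)` is a real `C^∞` manifold for the model `𝓘(ℝ, ℂⁿ)`
(`isManifold_real_of_isManifold_complex`). [cite: GriffithsHarrisPrinciples1978, Ch. 0 §2 p. 15] -/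
theorem isManifold_real_projectivization (n : ℕ) :
    IsManifold 𝓘(ℝ, Fin n → ℂ) ∞ (ℙ ℂ (Fin (n + 1) → ℂ)) :=
  haveI := isManifold_complex_projectivization n
  isManifold_real_of_isManifold_complex

/-! ### The identity between the two structures -/

namespace CPn

variable {n : ℕ}

/-- Local notation: `𝔼 n` is the model space `EuclideanSpace ℝ (Fin n)`. -/
local notation "𝔼" n:arg => EuclideanSpace ℝ (Fin n)

/-- The identity `ComplexProjectiveSpace n → ℙ ℂ (Fin (n + 1) → ℂ)` (same underlying type, two
charted structures). [folklore] -/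
def toP : ComplexProjectiveSpace n ≃ ℙ ℂ (Fin (n + 1) → ℂ) := Equiv.refl _

/-- `toP [v] = [v]`. [folklore] -/
@[simp]
theorem toP_mk (v : {v : Fin (n + 1) → ℂ // v ≠ 0}) :
    toP (ComplexProjectiveSpace.mk v) = Projectivization.mk ℂ v.1 v.2 := rfl

/-- `toP.symm [v] = [v]`. [folklore] -/
@[simp]
theorem toP_symm_mk (v : Fin (n + 1) → ℂ) (hv : v ≠ 0) :
    toP.symm (Projectivization.mk ℂ v hv) = ComplexProjectiveSpace.mk (n := n) ⟨v, hv⟩ := rfl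

/-- The real chart predicate `CoordNeZero i` is membership in the complex chart domain `Uᵢ`.
[folklore] -/
theorem coordNeZero_iff_mem_stdChartSource (i : Fin (n + 1)) (p : ComplexProjectiveSpace n) :
    CoordNeZero i p ↔ toP p ∈ stdChartSource i := by
  induction p using ComplexProjectiveSpace.ind with
  | h v => rw [coordNeZero_mk, toP_mk, mk_mem_stdChartSource_iff]

/-- The complex affine coordinates of the two structures agree: `affineCoordComplex i = φᵢ ∘ toP`.
[folklore] -/
theorem affineCoordComplex_eq_stdChartFun (i : Fin (n + 1)) (p : ComplexProjectiveSpace n) :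
    affineCoordComplex i p = stdChartFun i (toP p) := by
  induction p using ComplexProjectiveSpace.ind with
  | h v => rw [affineCoordComplex_mk, toP_mk, stdChartFun_mk]

/-- The inverse real chart is the inverse complex chart: `[homogenize i w] = φᵢ⁻¹ w`. [folklore] -/
theorem mk_homogenize (i : Fin (n + 1)) (w : Fin n → ℂ) :
    toP (ComplexProjectiveSpace.mk (homogenize i w)) = stdChartInv i w := rfl

/-- `toP` is continuous (it descends the quotient map of `ℂⁿ⁺¹ ∖ 0`). [folklore] -/
theorem continuous_toP : Continuous (toP : ComplexProjectiveSpace n → ℙ ℂ (Fin (n + 1) → ℂ)) := by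
  rw [ComplexProjectiveSpace.isQuotientMap_mk.continuous_iff]
  exact Projectivization.continuous_mk

/-- `toP.symm` is continuous. [folklore] -/
theorem continuous_toP_symm :
    Continuous (toP.symm : ℙ ℂ (Fin (n + 1) → ℂ) → ComplexProjectiveSpace n) := by
  rw [(Projectivization.isQuotientMap_mk (𝕜 := ℂ) (W := Fin (n + 1) → ℂ)).continuous_iff]
  exact ComplexProjectiveSpace.continuous_mk

/-! ### Extended charts of `ComplexProjectiveSpace n` -/

/-- The extended chart at `x₀` is `realCoordinates ∘ affineCoordComplex (chartIndex x₀)`.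
[folklore] -/
@[simp]
theorem extChartAt_apply (x₀ x : ComplexProjectiveSpace n) :
    extChartAt (𝓡 (2 * n)) x₀ x = realCoordinates n (affineCoordComplex (chartIndex x₀) x) := rfl

/-- The inverse extended chart at `x₀` is `w ↦ [homogenize (chartIndex x₀) (realCoordinates⁻¹ w)]`.
[folklore] -/
@[simp]
theorem extChartAt_symm_apply (x₀ : ComplexProjectiveSpace n) (y : 𝔼 (2 * n)) :
    (extChartAt (𝓡 (2 * n)) x₀).symm y =
      ComplexProjectiveSpace.mk (homogenize (chartIndex x₀) ((realCoordinates n).symm y)) := rfl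

/-- The affine charts belong to the maximal `C^∞` atlas. [folklore] -/
theorem affineChart_mem_maximalAtlas (i : Fin (n + 1)) :
    affineChart i ∈ IsManifold.maximalAtlas (𝓡 (2 * n)) ∞ (ComplexProjectiveSpace n) :=
  IsManifold.subset_maximalAtlas ⟨i, rfl⟩

variable {E' : Type*} [NormedAddCommGroup E'] [NormedSpace ℝ E'] {H' : Type*} [TopologicalSpace H']
  {I' : ModelWithCorners ℝ E' H'} {M : Type*} [TopologicalSpace M] [ChartedSpace H' M]

/-- **Smoothness into `ℂℙⁿ` in an affine chart.** A map `f : M → ℂℙⁿ` with `f x ∈ Uᵢ` is `C^∞` at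
`x` iff it is continuous at `x` and its complex affine coordinates `affineCoordComplex i ∘ f : M → ℂⁿ`
(real structure) are `C^∞` at `x` (Mathlib's `contMDiffWithinAt_iff_target_of_mem_maximalAtlas` in
the chart `affineChart i`, composed with the linear isomorphism `realCoordinates`). [folklore] -/
theorem contMDiffAt_iff_affineChart {f : M → ComplexProjectiveSpace n} {x : M} (i : Fin (n + 1))
    (hi : CoordNeZero i (f x)) :
    ContMDiffAt I' (𝓡 (2 * n)) ∞ f x ↔
      ContinuousAt f x ∧ ContMDiffAt I' 𝓘(ℝ, Fin n → ℂ) ∞ (fun y ↦ affineCoordComplex i (f y)) x := by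
  rw [← contMDiffWithinAt_univ,
    contMDiffWithinAt_iff_target_of_mem_maximalAtlas (affineChart_mem_maximalAtlas i) (by exact hi),
    continuousWithinAt_univ, contMDiffWithinAt_univ]
  refine and_congr_right fun _ ↦ ?_
  have hext : ((affineChart i : OpenPartialHomeomorph (ComplexProjectiveSpace n) _).extend
      (𝓡 (2 * n))) ∘ f =
      (realCoordinates n : (Fin n → ℂ) → 𝔼 (2 * n)) ∘ fun y ↦ affineCoordComplex i (f y) := by
    funext y
    simp [affineChart_apply, affineCoord]
  rw [hext]
  constructor
  · intro h
    have := (realCoordinates n).symm.contDiff.contMDiff.contMDiffAt.comp x h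
    simpa [Function.comp_def] using this
  · intro h
    exact (realCoordinates n).contDiff.contMDiff.contMDiffAt.comp x h

/-! ### `toP` is a diffeomorphism -/

/-- In the preferred charts at `x` and `toP x` the identity reads `φ_c ∘ φⱼ⁻¹ ∘ realCoordinates⁻¹`,
`j = chartIndex x`, `c = cidx (toP x)`. [folklore] -/
theorem writtenInExtChartAt_toP (x : ComplexProjectiveSpace n) (y : 𝔼 (2 * n)) :
    writtenInExtChartAt (𝓡 (2 * n)) 𝓘(ℝ, Fin n → ℂ) x (toP : ComplexProjectiveSpace n → _) y =
      (stdChartFun (cidx (toP x)) ∘ stdChartInv (chartIndex x)) ((realCoordinates n).symm y) := rfl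

/-- In the preferred charts at `p` and `toP.symm p` the identity reads
`realCoordinates ∘ φⱼ ∘ φ_c⁻¹`, `c = cidx p`, `j = chartIndex (toP.symm p)`. [folklore] -/
theorem writtenInExtChartAt_toP_symm (p : ℙ ℂ (Fin (n + 1) → ℂ)) (w : Fin n → ℂ) :
    writtenInExtChartAt 𝓘(ℝ, Fin n → ℂ) (𝓡 (2 * n)) p (toP.symm : _ → ComplexProjectiveSpace n) w =
      realCoordinates n ((stdChartFun (chartIndex (toP.symm p : ComplexProjectiveSpace n)) ∘
        stdChartInv (cidx p)) w) := by
  simp only [writtenInExtChartAt, comp_apply, extChartAt_apply, affineCoordComplex_eq_stdChartFun]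
  rfl

/-- At the centre of the chart of index `j` the homogenisation has non-zero `c`-th coordinate
whenever the point lies in `U_c`. [folklore] -/
theorem insertNth_one_ne_zero_of_mem {j c : Fin (n + 1)} {p : ℙ ℂ (Fin (n + 1) → ℂ)}
    (hj : p ∈ stdChartSource j) (hc : p ∈ stdChartSource c) :
    (Fin.insertNth j (1 : ℂ) (stdChartFun j p) : Fin (n + 1) → ℂ) c ≠ 0 := by
  have h : stdChartInv j (stdChartFun j p) ∈ stdChartSource c := by
    rwa [stdChartInv_stdChartFun j hj]
  rwa [stdChartInv, mk_mem_stdChartSource_iff] at h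

/-- **The identity `ComplexProjectiveSpace n → ℙⁿ(ℂ)` is `C^∞`** (real structures): in charts it is
a change of affine charts, real-analytic on a neighbourhood of the centre. [folklore] -/
theorem contMDiff_toP : ContMDiff (𝓡 (2 * n)) 𝓘(ℝ, Fin n → ℂ) ∞ (toP : ComplexProjectiveSpace n → _) := by
  intro x
  rw [contMDiffAt_iff]
  refine ⟨continuous_toP.continuousAt, ?_⟩
  set j := chartIndex x with hj
  set c := cidx (toP x) with hc
  have hxj : toP x ∈ stdChartSource j := (coordNeZero_iff_mem_stdChartSource j x).1 (coordNeZero_chartIndex x)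
  have hxc : toP x ∈ stdChartSource c := mem_stdChartSource_cidx (toP x)
  have hU : IsOpen {w : Fin n → ℂ | (Fin.insertNth j (1 : ℂ) w : Fin (n + 1) → ℂ) c ≠ 0} :=
    isOpen_setOf_insertNth_one_ne j c
  have hmem : (realCoordinates n).symm (extChartAt (𝓡 (2 * n)) x x) ∈
      {w : Fin n → ℂ | (Fin.insertNth j (1 : ℂ) w : Fin (n + 1) → ℂ) c ≠ 0} := by
    rw [extChartAt_apply, ContinuousLinearEquiv.symm_apply_apply, affineCoordComplex_eq_stdChartFun]
    exact insertNth_one_ne_zero_of_mem hxj hxc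
  have h1 : ContDiffAt ℝ ∞ (stdChartFun c ∘ stdChartInv j : (Fin n → ℂ) → Fin n → ℂ)
      ((realCoordinates n).symm (extChartAt (𝓡 (2 * n)) x x)) :=
    ((((contDiffOn_stdChartFun_comp_stdChartInv (𝕜 := ℂ) j c).of_le le_top).restrict_scalars ℝ).contDiffAt
      (hU.mem_nhds hmem))
  have h2 := h1.comp _ (realCoordinates n).symm.contDiff.contDiffAt
  exact h2.contDiffWithinAt

/-- **The identity `ℙⁿ(ℂ) → ComplexProjectiveSpace n` is `C^∞`** (real structures). [folklore] -/
theorem contMDiff_toP_symm :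
    ContMDiff 𝓘(ℝ, Fin n → ℂ) (𝓡 (2 * n)) ∞ (toP.symm : _ → ComplexProjectiveSpace n) := by
  intro p
  rw [contMDiffAt_iff]
  refine ⟨continuous_toP_symm.continuousAt, ?_⟩
  set j := chartIndex (toP.symm p : ComplexProjectiveSpace n) with hj
  set c := cidx p with hc
  have hpj : p ∈ stdChartSource j :=
    (coordNeZero_iff_mem_stdChartSource j (toP.symm p)).1 (coordNeZero_chartIndex _)
  have hpc : p ∈ stdChartSource c := mem_stdChartSource_cidx p
  have hU : IsOpen {w : Fin n → ℂ | (Fin.insertNth c (1 : ℂ) w : Fin (n + 1) → ℂ) j ≠ 0} :=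
    isOpen_setOf_insertNth_one_ne c j
  have hmem : extChartAt 𝓘(ℝ, Fin n → ℂ) p p ∈
      {w : Fin n → ℂ | (Fin.insertNth c (1 : ℂ) w : Fin (n + 1) → ℂ) j ≠ 0} :=
    insertNth_one_ne_zero_of_mem hpc hpj
  have h1 : ContDiffAt ℝ ∞ (stdChartFun j ∘ stdChartInv c : (Fin n → ℂ) → Fin n → ℂ)
      (extChartAt 𝓘(ℝ, Fin n → ℂ) p p) :=
    ((((contDiffOn_stdChartFun_comp_stdChartInv (𝕜 := ℂ) c j).of_le le_top).restrict_scalars ℝ).contDiffAt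
      (hU.mem_nhds hmem))
  have h2 := (realCoordinates n).contDiff.contDiffAt.comp _ h1
  have hwr : (extChartAt (𝓡 (2 * n)) (toP.symm p) ∘ (toP.symm : _ → ComplexProjectiveSpace n) ∘
      (extChartAt 𝓘(ℝ, Fin n → ℂ) p).symm) =
      (realCoordinates n) ∘ (stdChartFun j ∘ stdChartInv c : (Fin n → ℂ) → Fin n → ℂ) :=
    funext (writtenInExtChartAt_toP_symm p)
  rw [hwr]
  exact h2.contDiffWithinAt

/-- `toP` is differentiable. [folklore] -/
theorem mdifferentiableAt_toP (x : ComplexProjectiveSpace n) :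
    MDifferentiableAt (𝓡 (2 * n)) 𝓘(ℝ, Fin n → ℂ) (toP : ComplexProjectiveSpace n → _) x :=
  (contMDiff_toP x).mdifferentiableAt (by simp)

/-- `toP.symm` is differentiable. [folklore] -/
theorem mdifferentiableAt_toP_symm (p : ℙ ℂ (Fin (n + 1) → ℂ)) :
    MDifferentiableAt 𝓘(ℝ, Fin n → ℂ) (𝓡 (2 * n)) (toP.symm : _ → ComplexProjectiveSpace n) p :=
  (contMDiff_toP_symm p).mdifferentiableAt (by simp)

/-- `dtoP⁻¹ ∘ dtoP = id`. [folklore] -/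
theorem mfderiv_toP_symm_comp_mfderiv_toP (x : ComplexProjectiveSpace n) :
    (mfderiv 𝓘(ℝ, Fin n → ℂ) (𝓡 (2 * n)) (toP.symm : _ → ComplexProjectiveSpace n) (toP x)).comp
      (mfderiv (𝓡 (2 * n)) 𝓘(ℝ, Fin n → ℂ) (toP : ComplexProjectiveSpace n → _) x) =
      ContinuousLinearMap.id ℝ _ := by
  rw [← mfderiv_comp x (mdifferentiableAt_toP_symm (toP x)) (mdifferentiableAt_toP x)]
  have : (toP.symm : _ → ComplexProjectiveSpace n) ∘ (toP : ComplexProjectiveSpace n → _) = id :=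
    funext fun _ ↦ rfl
  rw [this, mfderiv_id]

/-- `dtoP ∘ dtoP⁻¹ = id`. [folklore] -/
theorem mfderiv_toP_comp_mfderiv_toP_symm (p : ℙ ℂ (Fin (n + 1) → ℂ)) :
    (mfderiv (𝓡 (2 * n)) 𝓘(ℝ, Fin n → ℂ) (toP : ComplexProjectiveSpace n → _) (toP.symm p)).comp
      (mfderiv 𝓘(ℝ, Fin n → ℂ) (𝓡 (2 * n)) (toP.symm : _ → ComplexProjectiveSpace n) p) =
      ContinuousLinearMap.id ℝ _ := by
  rw [← mfderiv_comp p (mdifferentiableAt_toP (toP.symm p)) (mdifferentiableAt_toP_symm p)]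
  have : (toP : ComplexProjectiveSpace n → _) ∘ (toP.symm : _ → ComplexProjectiveSpace n) = id :=
    funext fun _ ↦ rfl
  rw [this, mfderiv_id]

/-- **The differential of the identity `ComplexProjectiveSpace n → ℙⁿ(ℂ)` is bijective.** [folklore] -/
theorem bijective_mfderiv_toP (x : ComplexProjectiveSpace n) :
    Bijective (mfderiv (𝓡 (2 * n)) 𝓘(ℝ, Fin n → ℂ) (toP : ComplexProjectiveSpace n → _) x) := by
  constructor
  · intro v w h
    have := congrArg (mfderiv 𝓘(ℝ, Fin n → ℂ) (𝓡 (2 * n)) (toP.symm : _ → ComplexProjectiveSpace n)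
      (toP x)) h
    rw [← ContinuousLinearMap.comp_apply, ← ContinuousLinearMap.comp_apply,
      mfderiv_toP_symm_comp_mfderiv_toP] at this
    exact this
  · intro a
    refine ⟨mfderiv 𝓘(ℝ, Fin n → ℂ) (𝓡 (2 * n)) (toP.symm : _ → ComplexProjectiveSpace n) (toP x) a, ?_⟩
    have h := mfderiv_toP_comp_mfderiv_toP_symm (n := n) (toP x)
    have := congrArg (fun T ↦ T a) h
    exact this

end CPn

/-! ### The Fubini–Study symplectic form -/

namespace CPn

attribute [local instance] isManifold_complex_projectivization isManifold_real_projectivization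

variable {n : ℕ}

variable (n) in
/-- **The Fubini–Study symplectic form of `ℂℙⁿ`** on the tree's real-charted
`ComplexProjectiveSpace n`: the pull-back along the identity `toP` of the Kähler form
`ω_FS(v, w) = g_FS(Jv, w)` of the Fubini–Study metric. Huybrechts (2005), Examples 3.1.9 i);
McDuff–Salamon (2017), Example 4.3.3. [cite: HuybrechtsCG2005, §3.1 Examples 3.1.9 i) pp. 117–118] -/
def fsForm : MForm (𝓡 (2 * n)) (ComplexProjectiveSpace n) ℝ 2 :=
  (fubiniStudyMetric (n := n)).toRiemannianMetric.kaehlerForm.pullback (𝓡 (2 * n))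
    (toP : ComplexProjectiveSpace n → ℙ ℂ (Fin (n + 1) → ℂ))

/-- Evaluation of the Fubini–Study form: `ω(v, w) = ω_FS(dtoP v, dtoP w)`. [folklore] -/
theorem fsForm_apply (p : ComplexProjectiveSpace n) (v w : TangentSpace (𝓡 (2 * n)) p) :
    fsForm n p ![v, w] =
      (fubiniStudyMetric (n := n)).toRiemannianMetric.kaehlerForm (toP p)
        ![mfderiv (𝓡 (2 * n)) 𝓘(ℝ, Fin n → ℂ) (toP : ComplexProjectiveSpace n → _) p v,
          mfderiv (𝓡 (2 * n)) 𝓘(ℝ, Fin n → ℂ) (toP : ComplexProjectiveSpace n → _) p w] := by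
  rw [fsForm, MForm.pullback_apply]
  congr 1
  funext i
  fin_cases i <;> rfl

/-- The Fubini–Study form is smooth (pull-back of the smooth Kähler form of a smooth metric along a
`C^∞` map). [cite: HuybrechtsCG2005, §3.1 Examples 3.1.9 i) pp. 117–118] -/
theorem isSmoothForm_fsForm : IsSmoothForm (fsForm n) :=
  isSmoothForm_pullback contMDiff_toP
    (fubiniStudyMetric (n := n)).isSmoothForm_kaehlerForm_toRiemannianMetric

/-- The Fubini–Study form is closed (`d` commutes with pull-back, and `dω_FS = 0`,
`isClosedForm_kaehlerForm_fubiniStudyMetric`).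
[cite: HuybrechtsCG2005, §3.1 Examples 3.1.9 i) pp. 117–118] -/
theorem isClosedForm_fsForm : IsClosedForm (fsForm n) := by
  unfold IsClosedForm fsForm
  rw [mextDeriv_pullback contMDiff_toP
    (fubiniStudyMetric (n := n)).isSmoothForm_kaehlerForm_toRiemannianMetric]
  have h := isClosedForm_kaehlerForm_fubiniStudyMetric (n := n)
  unfold IsClosedForm at h
  rw [h]
  exact MForm.pullback_zero _

/-- **The Fubini–Study form is non-degenerate**: for `v ≠ 0` there is `w` with `ω(v, w) ≠ 0`:
`dtoP` is bijective and `ω_FS(a, Ja) = g_FS(a, a) > 0` for `a = dtoP v ≠ 0`; take `w` with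
`dtoP w = J a`. McDuff–Salamon (2017), Example 4.3.3.
[cite: HuybrechtsCG2005, §3.1 Examples 3.1.9 i) pp. 117–118] -/
theorem fsForm_nondegenerate (p : ComplexProjectiveSpace n) (v : TangentSpace (𝓡 (2 * n)) p)
    (hv : v ≠ 0) : ∃ w : TangentSpace (𝓡 (2 * n)) p, fsForm n p ![v, w] ≠ 0 := by
  have hbij := bijective_mfderiv_toP (n := n) p
  set a := mfderiv (𝓡 (2 * n)) 𝓘(ℝ, Fin n → ℂ) (toP : ComplexProjectiveSpace n → _) p v with ha
  have ha0 : a ≠ 0 := by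
    intro h
    apply hv
    apply hbij.1
    rw [← ha, h, map_zero]
  obtain ⟨w', hw'⟩ := isHermitian_fubiniStudyMetric.kaehlerForm_nondegenerate (toP p) a ha0
  obtain ⟨w, hw⟩ := hbij.2 w'
  refine ⟨w, ?_⟩
  rw [fsForm_apply, ← ha, hw]
  exact hw'

end CPn

end Literature.Geometry.Kaehler
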